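import Mathlib
import Literature.RingTheory.Multisymmetric.Weyl
import Literature.NumberTheory.DiophantineGeometry.SchurWeylPlethysm
import Summits.ValiantsHypothesis.ValiantsHypothesis.Theorems.ValuativeGCTCutBitesDetStabTranspose

/-!
# The diagonal pencil of `det_m` and its coefficients (elementary multisymmetric polynomials)

Wall-breaker axis D (det-orbit-closure multiplicity bounds) for crux `ValuativeGCT.ValuativeFlip`
(stmt-ValiantsHypothesis-12624): the algebraic half of the det-side theorem "no equations of `Det_m`
of small body".  Fix a base letter `i₀ : MatIdx m` and put the other letters `i ≠ i₀` on the `m`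
points of `Literature/RingTheory/Multisymmetric/Weyl.lean` (variables `X (i, a)`, `a : Fin m`, over
the coefficient ring `R = k[X (i, a)]`).  The DIAGONAL PENCIL is the (singular) linear substitution
`A` of `det_m` with `X_(a,a) ↦ x_{i₀} + ∑_{i ≠ i₀} X(i,a) • x_i` and `X_(a,b) ↦ 0` (`a ≠ b`), so that
`A · det_m = ∏_a (x_{i₀} + ⟨t_a, x⟩)` is a product of `m` generic linear forms through `x_{i₀}`.

* `map_detFormLex_eq_det_of` — `det_m` base-changed to any commutative ring is the determinant of the
  matrix of variables (from the landed `CutBitesAdjugate.cbAdjTr_detFormLex_eq_det`);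
  `linSubst_map_detFormLex_of_offDiag_eq_zero` — a substitution killing the off-diagonal variables turns
  `det_m` into the product of the images of the diagonal variables.
* `aeval_dehomog_monomial`, `coeff_subtypeDomain_aeval_dehomog` — dehomogenisation `x_{i₀} ↦ 1`:
  for a form `P` of degree `|d|`, the coefficient of `x^d` in `P` is the coefficient of `x^{d|_{i ≠ i₀}}`
  in `P(x_{i₀} = 1)`; `eq_of_subtypeDomain_eq_of_degree_eq` — `d` is recovered from `d|_{i ≠ i₀}` and `|d|`.
* `aeval_dehomog_linSubst_diagPencil_detFormLex` — dehomogenising the diagonal pencil of `det_m` gives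
  Weyl's generating product `genElem = ∏_a (1 + ∑_i X(i,a) T_i)`; hence
  (`coeff_linSubst_diagPencil_detFormLex`) **the coefficient of `x^d` (`|d| = m`) in `A · det_m` is the
  elementary multisymmetric polynomial `e_{d|_{i ≠ i₀}}(t_1, …, t_m)`**.

All statements are over an arbitrary field `k` (any commutative ring for the first two).  No new
definitions. [folklore]
-/

set_option linter.dupNamespace false

namespace Summit.ValiantsHypothesis.ValiantsHypothesis.Theorems.ValuativeFlip

open MvPolynomial
open scoped BigOperators Matrix
open Literature.NumberTheory.DiophantineGeometry
open Literature.Computability.AlgebraicComplexity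
open Literature.RingTheory.Multisymmetric

noncomputable section

/-! ### `det_m` under substitutions killing the off-diagonal variables -/

/-- Base change: `det_m` with coefficients extended along `φ : k → R` is the determinant of the matrix
of variables over `R`. [folklore] -/
theorem map_detFormLex_eq_det_of {k : Type*} [Field k] {R : Type*} [CommRing R] (φ : k →+* R)
    (m : ℕ) :
    map φ (detFormLex k m) =
      (Matrix.of fun a b : Fin m => (X (toLex (a, b)) : MvPolynomial (MatIdx m) R)).det := by
  rw [CutBitesAdjugate.cbAdjTr_detFormLex_eq_det, RingHom.map_det]
  congr 1
  ext a b : 2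
  simp [Matrix.map_apply, map_X]

/-- A linear substitution whose matrix vanishes on the off-diagonal variables `X_(a,b)`, `a ≠ b`, maps
`det_m` (base-changed along `φ`) to the product of the images of the diagonal variables. [folklore] -/
theorem linSubst_map_detFormLex_of_offDiag_eq_zero {k : Type*} [Field k] {R : Type*} [CommRing R]
    (φ : k →+* R) {m : ℕ} (A : Matrix (MatIdx m) (MatIdx m) R)
    (hA : ∀ (l : MatIdx m) (a b : Fin m), a ≠ b → A l (toLex (a, b)) = 0) :
    linSubst (MatIdx m) R A (map φ (detFormLex k m)) =
      ∏ a : Fin m, ∑ l : MatIdx m, A l (toLex (a, a)) • (X l : MvPolynomial (MatIdx m) R) := by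
  rw [map_detFormLex_eq_det_of, AlgHom.map_det]
  have hM : (linSubst (MatIdx m) R A).mapMatrix
      (Matrix.of fun a b : Fin m => (X (toLex (a, b)) : MvPolynomial (MatIdx m) R)) =
      Matrix.diagonal fun a => ∑ l : MatIdx m, A l (toLex (a, a)) • (X l : MvPolynomial (MatIdx m) R) := by
    refine Matrix.ext fun a b => ?_
    rw [AlgHom.mapMatrix_apply, Matrix.map_apply, Matrix.of_apply, linSubst_X, Matrix.diagonal_apply]
    split_ifs with h
    · subst h; rfl
    · exact Finset.sum_eq_zero fun l _ => by rw [hA l a b h, zero_smul]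
  rw [hM, Matrix.det_diagonal]

/-! ### Dehomogenisation `x_{i₀} ↦ 1` -/

section Dehomog

variable {σ : Type*} [DecidableEq σ] {R : Type*} [CommRing R] (i₀ : σ)

/-- `|d| = |d|_{i ≠ i₀}| + d i₀`. [folklore] -/
theorem degree_eq_degree_subtypeDomain_add (d : σ →₀ ℕ) :
    d.degree = (d.subtypeDomain fun i => i ≠ i₀).degree + d i₀ := by
  classical
  rw [Finsupp.degree_apply, Finsupp.degree_apply, Finsupp.support_subtypeDomain]
  simp only [Finsupp.subtypeDomain_apply]
  rw [Finset.sum_subtype_eq_sum_filter (f := fun i => d i),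
    ← Finset.sum_filter_add_sum_filter_not d.support (fun i => i ≠ i₀)]
  congr 1
  rw [Finset.sum_filter]
  simp only [ne_eq, Decidable.not_not, Finset.sum_ite_eq', Finsupp.mem_support_iff]
  split_ifs with h <;> omega

/-- An exponent is determined by its restriction to the letters `≠ i₀` and its degree. [folklore] -/
theorem eq_of_subtypeDomain_eq_of_degree_eq {d d' : σ →₀ ℕ}
    (h : d.subtypeDomain (fun i => i ≠ i₀) = d'.subtypeDomain fun i => i ≠ i₀)
    (hdeg : d.degree = d'.degree) : d = d' := by
  have h0 : d i₀ = d' i₀ := by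
    have h1 := degree_eq_degree_subtypeDomain_add i₀ d
    have h2 := degree_eq_degree_subtypeDomain_add i₀ d'
    rw [h] at h1
    omega
  ext i
  by_cases hi : i = i₀
  · subst hi; exact h0
  · have := congrArg (fun e => e ⟨i, hi⟩) h
    simpa only [Finsupp.subtypeDomain_apply] using this

/-- Dehomogenisation on monomials: `x_{i₀} ↦ 1` sends `c x^d` to `c x^{d|_{i ≠ i₀}}`. [folklore] -/
theorem aeval_dehomog_monomial (d : σ →₀ ℕ) (c : R) :
    aeval (fun l : σ => if h : l = i₀ then (1 : MvPolynomial {i : σ // i ≠ i₀} R) else X ⟨l, h⟩)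
        (monomial d c) = monomial (d.subtypeDomain fun i => i ≠ i₀) c := by
  classical
  set F : σ → MvPolynomial {i : σ // i ≠ i₀} R := fun l =>
    (if h : l = i₀ then (1 : MvPolynomial {i : σ // i ≠ i₀} R) else X ⟨l, h⟩) ^ d l with hF
  have hL : d.prod (fun l e => (if h : l = i₀ then (1 : MvPolynomial {i : σ // i ≠ i₀} R)
      else X ⟨l, h⟩) ^ e) = ∏ l ∈ d.support.filter (fun i => i ≠ i₀), F l := by
    rw [Finsupp.prod, ← Finset.prod_filter_mul_prod_filter_not d.support (fun i => i ≠ i₀)]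
    have h1 : ∏ l ∈ d.support.filter (fun i => ¬ (i ≠ i₀)), F l = 1 := by
      refine Finset.prod_eq_one fun l hl => ?_
      have hl' : l = i₀ := by simpa using (Finset.mem_filter.mp hl).2
      subst hl'
      simp [hF]
    exact (congrArg₂ (· * ·) rfl h1).trans (mul_one _)
  have hR : (d.subtypeDomain fun i => i ≠ i₀).prod
      (fun i e => (X i : MvPolynomial {i : σ // i ≠ i₀} R) ^ e) =
      ∏ l ∈ d.support.filter (fun i => i ≠ i₀), F l := by
    rw [Finsupp.prod, Finsupp.support_subtypeDomain, ← Finset.prod_subtype_eq_prod_filter]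
    refine Finset.prod_congr rfl fun x _ => ?_
    rw [Finsupp.subtypeDomain_apply, hF]
    simp only [dif_neg x.2, Subtype.coe_eta]
  rw [aeval_monomial, monomial_eq, MvPolynomial.algebraMap_eq, hL, hR]

/-- For a form `P` of degree `|d|`, the coefficient of `x^d` in `P` is the coefficient of
`x^{d|_{i ≠ i₀}}` in its dehomogenisation `P(x_{i₀} = 1)`. [folklore] -/
theorem coeff_subtypeDomain_aeval_dehomog {P : MvPolynomial σ R} {D : ℕ} (hP : P.IsHomogeneous D)
    (d : σ →₀ ℕ) (hd : d.degree = D) :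
    coeff (d.subtypeDomain fun i => i ≠ i₀)
        (aeval (fun l : σ => if h : l = i₀ then (1 : MvPolynomial {i : σ // i ≠ i₀} R) else X ⟨l, h⟩) P) =
      coeff d P := by
  classical
  conv_lhs => rw [← support_sum_monomial_coeff P, map_sum]
  simp only [aeval_dehomog_monomial, coeff_sum, coeff_monomial]
  rw [Finset.sum_eq_single d]
  · rw [if_pos rfl]
  · intro d' hd' hne
    rw [if_neg]
    intro h
    apply hne
    refine eq_of_subtypeDomain_eq_of_degree_eq i₀ h ?_
    rw [hd]
    have := hP (mem_support_iff.mp hd')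
    rwa [Finsupp.degree_eq_weight_one]
  · intro h
    rw [notMem_support_iff.mp h, if_pos rfl]

end Dehomog

/-! ### The diagonal pencil of `det_m` -/

section Pencil

variable {k : Type*} [Field k] {m : ℕ} (i₀ : MatIdx m)

/-- **The diagonal pencil of `det_m` is a product of `m` linear forms through `x_{i₀}`**: with the
other letters `i ≠ i₀` placed on `m` points (`X (i, a)`), the substitution
`X_(a,a) ↦ x_{i₀} + ∑_{i ≠ i₀} X(i,a) x_i`, `X_(a,b) ↦ 0` (`a ≠ b`) maps `det_m` to
`∏_a (x_{i₀} + ∑_{i ≠ i₀} X(i,a) x_i)`. [folklore] -/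
theorem linSubst_diagPencil_map_detFormLex :
    linSubst (MatIdx m) (MvPolynomial ({i : MatIdx m // i ≠ i₀} × Fin m) k)
        (fun (l j : MatIdx m) => if (ofLex j).1 = (ofLex j).2 then
          (if h : l = i₀ then (1 : MvPolynomial ({i : MatIdx m // i ≠ i₀} × Fin m) k)
            else X (⟨l, h⟩, (ofLex j).1)) else 0)
        (map (C : k →+* MvPolynomial ({i : MatIdx m // i ≠ i₀} × Fin m) k) (detFormLex k m)) =
      ∏ a : Fin m, ((X i₀ : MvPolynomial (MatIdx m) (MvPolynomial ({i : MatIdx m // i ≠ i₀} × Fin m) k))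
        + ∑ x : {i : MatIdx m // i ≠ i₀},
          (X (x, a) : MvPolynomial ({i : MatIdx m // i ≠ i₀} × Fin m) k) • X x.1) := by
  classical
  rw [linSubst_map_detFormLex_of_offDiag_eq_zero]
  · refine Finset.prod_congr rfl fun a _ => ?_
    rw [← Finset.add_sum_erase Finset.univ _ (Finset.mem_univ i₀)]
    congr 1
    · simp
    · rw [Finset.sum_subtype (Finset.univ.erase i₀) (p := fun i : MatIdx m => i ≠ i₀)
        (fun i => by simp)]
      refine Finset.sum_congr rfl fun x _ => ?_
      simp [dif_neg x.2]
  · intro l a b hab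
    simp [if_neg hab]

/-- **Dehomogenising the diagonal pencil of `det_m` gives Weyl's generating product**
`genElem = ∏_a (1 + ∑_i X(i,a) T_i)` (`x_{i₀} ↦ 1`, `x_i ↦ T_i`). [folklore] -/
theorem aeval_dehomog_linSubst_diagPencil_detFormLex :
    aeval (fun l : MatIdx m => if h : l = i₀ then
        (1 : MvPolynomial {i : MatIdx m // i ≠ i₀} (MvPolynomial ({i : MatIdx m // i ≠ i₀} × Fin m) k))
        else X ⟨l, h⟩)
      (linSubst (MatIdx m) (MvPolynomial ({i : MatIdx m // i ≠ i₀} × Fin m) k)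
        (fun (l j : MatIdx m) => if (ofLex j).1 = (ofLex j).2 then
          (if h : l = i₀ then (1 : MvPolynomial ({i : MatIdx m // i ≠ i₀} × Fin m) k)
            else X (⟨l, h⟩, (ofLex j).1)) else 0)
        (map (C : k →+* MvPolynomial ({i : MatIdx m // i ≠ i₀} × Fin m) k) (detFormLex k m))) =
      genElem {i : MatIdx m // i ≠ i₀} m := by
  classical
  rw [linSubst_diagPencil_map_detFormLex, map_prod, genElem]
  refine Finset.prod_congr rfl fun a _ => ?_
  rw [map_add, map_sum, aeval_X, dif_pos rfl, zLin]
  refine congrArg (fun z => 1 + z) (Finset.sum_congr rfl fun x _ => ?_)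
  simp [dif_neg x.2, smul_eq_C_mul, MvPolynomial.algebraMap_eq]

/-- The diagonal pencil of `det_m` is a form of degree `m`. [folklore] -/
theorem linSubst_diagPencil_detFormLex_isHomogeneous :
    (linSubst (MatIdx m) (MvPolynomial ({i : MatIdx m // i ≠ i₀} × Fin m) k)
        (fun (l j : MatIdx m) => if (ofLex j).1 = (ofLex j).2 then
          (if h : l = i₀ then (1 : MvPolynomial ({i : MatIdx m // i ≠ i₀} × Fin m) k)
            else X (⟨l, h⟩, (ofLex j).1)) else 0)
        (map (C : k →+* MvPolynomial ({i : MatIdx m // i ≠ i₀} × Fin m) k)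
          (detFormLex k m))).IsHomogeneous m :=
  linSubst_isHomogeneous _ ((detFormLex_isHomogeneous k m).map _)

end Pencil

/-- **The coefficients of the diagonal pencil of `det_m` are the elementary multisymmetric
polynomials**: for `|d| = m`, the coefficient of `x^d` in `∏_a (x_{i₀} + ∑_{i ≠ i₀} X(i,a) x_i)` is
`e_{d|_{i ≠ i₀}}(t_1, …, t_m)` (`elemMultisymm`).  Registered sub-goal of the crux (wall-breaker k7,
axis D). [folklore] -/
theorem coeff_linSubst_diagPencil_detFormLex {k : Type*} [Field k] {m : ℕ} (i₀ : MatIdx m) (d : MatIdx m →₀ ℕ) (hd : d.degree = m) : coeff d (linSubst (MatIdx m) (MvPolynomial ({i : MatIdx m // i ≠ i₀} × Fin m) k) (fun (l j : MatIdx m) => if (ofLex j).1 = (ofLex j).2 then (if h : l = i₀ then (1 : MvPolynomial ({i : MatIdx m // i ≠ i₀} × Fin m) k) else X (⟨l, h⟩, (ofLex j).1)) else 0) (map (C : k →+* MvPolynomial ({i : MatIdx m // i ≠ i₀} × Fin m) k) (detFormLex k m))) = elemMultisymm {i : MatIdx m // i ≠ i₀} m (d.subtypeDomain fun i => i ≠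 i₀) := by
  rw [← coeff_subtypeDomain_aeval_dehomog i₀ (linSubst_diagPencil_detFormLex_isHomogeneous i₀) d hd,
    aeval_dehomog_linSubst_diagPencil_detFormLex, elemMultisymm]


end

end Summit.ValiantsHypothesis.ValiantsHypothesis.Theorems.ValuativeFlip
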